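import Literature.Geometry.Lorentzian.KerrTortoiseRadiusSurj
import Literature.Geometry.Lorentzian.KerrSurfaceGravity
import Literature.Geometry.Lorentzian.KerrSeparatedPotentialBounds
import Literature.Geometry.Lorentzian.KerrSeparatedPotentialPartition
import HarnessLib

/-!
# Tortoise lengths of radial zones and monotone partitions of Carter's coefficient along `r*`
(namespace `Literature.Geometry.Lorentzian.Kerr`, dot-notation API on `Kerr.IsTortoiseRadius`.)

Bookkeeping used by every `r*`-estimate of the separated wave equation on Kerr
(Dafermos–Rodnianski–Shlapentokh-Rothman, arXiv:1402.7034, §2.1.2 and §8: "the region `r ≤ R`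
corresponds to `r* ≤ R*`, with `r* ∼ (2κ)⁻¹ log(r − r₊)` near the horizon"):

* `IsTortoiseRadius.sub_le_mul_log_div` — NEAR ZONE: for `x ≤ y` with `ρ y ≤ 7M`,
  `y − x ≤ (25/κ)·(log(ρ y − r₊) − log(ρ x − r₊))`, `κ = Kerr.surfaceGravity M a`
  (from `d/dx log(ρ − r₊) = (ρ − r₋)/(ρ² + a²) ≥ (r₊ − r₋)/(50M²) = κ(r₊² + a²)/(25M²) ≥ κ/25`);
* `IsTortoiseRadius.sub_le_mul_sub` — FAR ZONE: for `x ≤ y` with `7M ≤ ρ x`,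
  `y − x ≤ (7/5)(ρ y − ρ x)` (from `dρ/dx = Δ/(ρ² + a²) ≥ 1 − 2M/ρ ≥ 5/7`);
* `IsTortoiseRadius.hasDerivAt_omega_sq_sub_sepPotential` — the coefficient
  `φ(x) = ω² − V(ρ x)` of Carter's equation `u″ + φ u = 0` has derivative `−V′(ρ x)·Δ/(ρ² + a²)`;
* `IsTortoiseRadius.exists_monotone_partition` — for `x_a < x_b` the interval `[x_a, x_b]` splits into
  at most eight consecutive pieces on each of which `φ` is monotone or antitone (the ≤ 7 critical points
  of `V = Kerr.sepPotential` on `(r₊, ∞)`, `Kerr.sepPotential_monotone_partition`, read through the strictly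
  increasing bijection `ρ : ℝ → (r₊, ∞)`).

## References
* M. Dafermos, I. Rodnianski, Y. Shlapentokh-Rothman, arXiv:1402.7034 = Ann. of Math. 183 (2016),
  §2.1.2, §6.3 (Lemma 6.3.1), §8 (key `DafermosRodnianskiShlapentokhrothman2014`).
-/

noncomputable section

open Filter Set
open scoped _root_.Topology

namespace Literature.Geometry.Lorentzian

namespace Kerr

namespace IsTortoiseRadius

variable {M a : ℝ} {ρ : ℝ → ℝ}

/-! ### Near zone: `r*`-lengths are at most `(25/κ)·log`-ratios of `r − r₊` -/

/-- The rate `(ρ − r₋)/(ρ² + a²)` of `log(ρ − r₊)` along `r*` is at least `κ/25` while `ρ ≤ 7M`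
(`ρ − r₋ ≥ r₊ − r₋ = 2κ(r₊² + a²) ≥ 2κM²`, `ρ² + a² ≤ 50M²`). [folklore] -/
theorem surfaceGravity_div_le_rate (hMa : IsSubextremal M a) {r : ℝ} (hr : rPlus M a < r)
    (hr7 : r ≤ 7 * M) : surfaceGravity M a / 25 ≤ (r - rMinus M a) / (r ^ 2 + a ^ 2) := by
  have hM : 0 < M := hMa.pos
  have haM : |a| ≤ M := le_of_lt hMa
  have ha2 : a ^ 2 ≤ M ^ 2 := by nlinarith [sq_abs a, abs_nonneg a]
  have hMr : M ≤ rPlus M a := M_le_rPlus M a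
  have hκ : surfaceGravity M a = (rPlus M a - rMinus M a) / (2 * (rPlus M a ^ 2 + a ^ 2)) :=
    surfaceGravity_eq_rPlus_sub_rMinus_div M a
  have hr0 : 0 < rPlus M a := rPlus_pos hM a
  have hD : 0 < rPlus M a ^ 2 + a ^ 2 := by positivity
  have hsub : rPlus M a - rMinus M a = surfaceGravity M a * (2 * (rPlus M a ^ 2 + a ^ 2)) := by
    rw [hκ]; field_simp
  have hκ0 : 0 ≤ surfaceGravity M a := surfaceGravity_nonneg M a
  have h1 : surfaceGravity M a * (2 * M ^ 2) ≤ r - rMinus M a := by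
    calc surfaceGravity M a * (2 * M ^ 2) ≤ surfaceGravity M a * (2 * (rPlus M a ^ 2 + a ^ 2)) := by
          apply mul_le_mul_of_nonneg_left _ hκ0; nlinarith [sq_nonneg a]
      _ = rPlus M a - rMinus M a := hsub.symm
      _ ≤ r - rMinus M a := by linarith
  have h2 : r ^ 2 + a ^ 2 ≤ 50 * M ^ 2 := by nlinarith
  have h3 : 0 < r ^ 2 + a ^ 2 := by
    have : 0 < r := (rPlus_pos hM a).trans hr
    positivity
  rw [div_le_div_iff₀ (by norm_num : (0 : ℝ) < 25) h3]
  nlinarith [mul_nonneg hκ0 (sub_nonneg.2 h2)]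

/-- **Near-zone tortoise length**: for `x ≤ y` with `ρ y ≤ 7M` (and `|a| < M`),
`y − x ≤ (25/κ)·(log(ρ y − r₊) − log(ρ x − r₊))` — the function `log(ρ − r₊) − (κ/25)·id` is
non-decreasing there. DRSR arXiv:1402.7034, §2.1.2 ("`r* ∼ (2κ)⁻¹ log(r − r₊)`"), made quantitative.
[cite: DafermosRodnianskiShlapentokhrothman2014, §2.1.2] -/
theorem sub_le_mul_log_div (hρ : IsTortoiseRadius M a ρ) (hMa : IsSubextremal M a) {x y : ℝ}
    (hxy : x ≤ y) (hy : ρ y ≤ 7 * M) :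
    y - x ≤ 25 / surfaceGravity M a * (Real.log (ρ y - rPlus M a) - Real.log (ρ x - rPlus M a)) := by
  have hκ : 0 < surfaceGravity M a := hMa.surfaceGravity_pos
  -- `g s = log(ρ s − r₊) − (κ/25) s` is monotone on `[x, y]`
  set g : ℝ → ℝ := fun s ↦ Real.log (ρ s - rPlus M a) - surfaceGravity M a / 25 * s with hg
  have hderiv : ∀ s, HasDerivAt g
      ((ρ s - rMinus M a) / (ρ s ^ 2 + a ^ 2) - surfaceGravity M a / 25) s := by
    intro s
    have hpos : 0 < ρ s - rPlus M a := sub_pos.2 (hρ.rPlus_lt s)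
    have h1 : HasDerivAt (fun s ↦ ρ s - rPlus M a) (delta M a (ρ s) / (ρ s ^ 2 + a ^ 2)) s :=
      (hρ.hasDerivAt s).sub_const _
    have h2 := h1.log hpos.ne'
    have e : delta M a (ρ s) / (ρ s ^ 2 + a ^ 2) / (ρ s - rPlus M a) =
        (ρ s - rMinus M a) / (ρ s ^ 2 + a ^ 2) := by
      rw [delta_eq_mul (le_of_lt hMa)]
      field_simp
    rw [e] at h2
    exact h2.sub ((hasDerivAt_id s).const_mul _ |>.congr_deriv (by simp))
  have hmono : MonotoneOn g (Icc x y) := by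
    refine monotoneOn_of_hasDerivWithinAt_nonneg (convex_Icc x y)
      (fun s _ ↦ (hderiv s).continuousAt.continuousWithinAt)
      (fun s _ ↦ (hderiv s).hasDerivWithinAt) fun s hs ↦ ?_
    rw [interior_Icc] at hs
    have hs7 : ρ s ≤ 7 * M := ((hρ.strictMono hMa).monotone hs.2.le).trans hy
    linarith [surfaceGravity_div_le_rate hMa (hρ.rPlus_lt s) hs7]
  have hgxy : g x ≤ g y := hmono (left_mem_Icc.2 hxy) (right_mem_Icc.2 hxy) hxy
  simp only [hg] at hgxy
  rw [div_mul_eq_mul_div, le_div_iff₀ hκ]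
  nlinarith

/-! ### Far zone: `r*`-lengths are at most `7/5` of `r`-lengths -/

/-- For `ρ ≥ 7M` (indeed `≥ 2M` would do with another constant), `dρ/dx = Δ/(ρ² + a²) ≥ 5/7`.
[folklore] -/
theorem five_div_seven_le_deriv (hMa : IsSubextremal M a) {r : ℝ} (hr : 7 * M ≤ r) :
    (5 : ℝ) / 7 ≤ delta M a r / (r ^ 2 + a ^ 2) := by
  have hM : 0 < M := hMa.pos
  have hr0 : 0 < r := by linarith
  have hD : 0 < r ^ 2 + a ^ 2 := by positivity
  rw [div_le_div_iff₀ (by norm_num : (0 : ℝ) < 7) hD]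
  unfold delta
  nlinarith [sq_nonneg a, mul_pos hM hr0]

/-- **Far-zone tortoise length**: for `x ≤ y` with `7M ≤ ρ x` (and `|a| < M`),
`y − x ≤ (7/5)(ρ y − ρ x)`. [cite: DafermosRodnianskiShlapentokhrothman2014, §2.1.2] -/
theorem sub_le_mul_sub (hρ : IsTortoiseRadius M a ρ) (hMa : IsSubextremal M a) {x y : ℝ}
    (hxy : x ≤ y) (hx : 7 * M ≤ ρ x) : y - x ≤ 7 / 5 * (ρ y - ρ x) := by
  set g : ℝ → ℝ := fun s ↦ ρ s - 5 / 7 * s with hg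
  have hderiv : ∀ s, HasDerivAt g (delta M a (ρ s) / (ρ s ^ 2 + a ^ 2) - 5 / 7) s := fun s ↦
    (hρ.hasDerivAt s).sub ((hasDerivAt_id s).const_mul _ |>.congr_deriv (by simp))
  have hmono : MonotoneOn g (Icc x y) := by
    refine monotoneOn_of_hasDerivWithinAt_nonneg (convex_Icc x y)
      (fun s _ ↦ (hderiv s).continuousAt.continuousWithinAt)
      (fun s _ ↦ (hderiv s).hasDerivWithinAt) fun s hs ↦ ?_
    rw [interior_Icc] at hs
    have hs7 : 7 * M ≤ ρ s := hx.trans ((hρ.strictMono hMa).monotone hs.1.le)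
    linarith [five_div_seven_le_deriv hMa hs7]
  have hgxy : g x ≤ g y := hmono (left_mem_Icc.2 hxy) (right_mem_Icc.2 hxy) hxy
  simp only [hg] at hgxy
  linarith

/-! ### Carter's coefficient along `r*`: derivative and monotone partition -/

/-- The coefficient `φ(x) = ω² − V(ρ x)` of Carter's equation has derivative
`−V′(ρ x)·Δ(ρ x)/(ρ x² + a²)` (chain rule; `V = Kerr.sepPotential`). [folklore] -/
theorem hasDerivAt_omega_sq_sub_sepPotential (hρ : IsTortoiseRadius M a ρ) (hMa : IsSubextremal M a)
    (ω : ℝ) (m : ℤ) (Λ : ℝ) (x : ℝ) :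
    HasDerivAt (fun y ↦ ω ^ 2 - sepPotential M a ω m Λ (ρ y))
      (-(deriv (sepPotential M a ω m Λ) (ρ x) * (delta M a (ρ x) / (ρ x ^ 2 + a ^ 2)))) x := by
  have hne : ρ x ^ 2 + a ^ 2 ≠ 0 := (hρ.sq_add_sq_pos hMa x).ne'
  have hV := (hasDerivAt_sepPotential M a ω m Λ hne).comp x (hρ.hasDerivAt x)
  have e : deriv (sepPotential M a ω m Λ) (ρ x) =
      critPoly M a ω m Λ (ρ x) / (ρ x ^ 2 + a ^ 2) ^ 3 + critPoly₁ M a (ρ x) / (ρ x ^ 2 + a ^ 2) ^ 5 :=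
    deriv_sepPotential_eq M a ω m Λ hne
  rw [e]
  exact (hasDerivAt_const x (ω ^ 2)).sub hV |>.congr_deriv (by ring)

/-- **Monotone partition of `[x_a, x_b]` for `φ = ω² − V ∘ ρ`** (at most eight pieces): for
`0 < M`, `|a| < M`, an admissible triple and `x_a < x_b` there are `k ≤ 8` and
`t 0 = x_a ≤ t 1 ≤ ⋯ ≤ t k = x_b` with `φ` monotone or antitone on each `[t i, t (i+1)]`.
From `Kerr.sepPotential_monotone_partition` (≤ 7 critical points of `V` on `(r₊, ∞)`, DRSR Lemma 6.3.1
extended to `V₀ + V₁`) transported by the strictly increasing bijection `ρ` onto `(r₊, ∞)`; the pieces of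
the `r`-partition lying below `ρ x_a` collapse to the point `x_a`.
[cite: DafermosRodnianskiShlapentokhrothman2014, Lemma 6.3.1] -/
theorem exists_monotone_partition (hρ : IsTortoiseRadius M a ρ) (hMa : IsSubextremal M a)
    {ω Λ : ℝ} {m : ℤ} (hadm : IsAdmissibleTriple a ω m Λ) {xa xb : ℝ} (hab : xa < xb) :
    ∃ (k : ℕ) (t : ℕ → ℝ), k ≤ 8 ∧ t 0 = xa ∧ t k = xb ∧ (∀ i < k, t i ≤ t (i + 1)) ∧
      ∀ i < k, MonotoneOn (fun y ↦ ω ^ 2 - sepPotential M a ω m Λ (ρ y)) (Icc (t i) (t (i + 1))) ∨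
        AntitoneOn (fun y ↦ ω ^ 2 - sepPotential M a ω m Λ (ρ y)) (Icc (t i) (t (i + 1))) := by
  have hM : 0 < M := hMa.pos
  have hbr : rPlus M a < ρ xb := hρ.rPlus_lt xb
  obtain ⟨k, tr, hk, h0, hkb, hlt, hmono⟩ := sepPotential_monotone_partition hM hMa hadm hbr
  -- a right inverse of `ρ` on `(r₊, ∞)`, junk `xa` elsewhere
  classical
  let ρinv : ℝ → ℝ := fun r ↦ if h : rPlus M a < r then (hρ.exists_apply_eq h).choose else xa
  have hρinv : ∀ {r}, rPlus M a < r → ρ (ρinv r) = r := by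
    intro r hr
    simp only [ρinv, dif_pos hr]
    exact (hρ.exists_apply_eq hr).choose_spec
  have hinv_apply : ∀ x, ρinv (ρ x) = x := fun x ↦
    hρ.injective hMa (hρinv (hρ.rPlus_lt x))
  -- the clipped partition
  let t : ℕ → ℝ := fun i ↦ ρinv (max (tr i) (ρ xa))
  have hclip : ∀ i, rPlus M a < max (tr i) (ρ xa) := fun i ↦
    lt_max_of_lt_right (hρ.rPlus_lt xa)
  have hρt : ∀ i, ρ (t i) = max (tr i) (ρ xa) := fun i ↦ hρinv (hclip i)
  have htr_mono : ∀ i j, i ≤ j → j ≤ k → tr i ≤ tr j := by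
    intro i j hij hjk
    induction j with
    | zero => simp at hij; rw [hij]
    | succ j ih =>
      rcases Nat.eq_or_lt_of_le hij with h | h
      · rw [h]
      · exact (ih (Nat.lt_succ_iff.1 h) (Nat.le_of_succ_le hjk)).trans
          (hlt j (Nat.lt_of_succ_le hjk)).le
  refine ⟨k, t, hk, ?_, ?_, fun i hi ↦ ?_, fun i hi ↦ ?_⟩
  · -- `t 0 = xa`
    apply hρ.injective hMa
    rw [hρt, h0, max_eq_right (hρ.rPlus_lt xa).le]
  · -- `t k = xb`
    apply hρ.injective hMa
    rw [hρt, hkb, max_eq_left ((hρ.strictMono hMa).monotone hab.le)]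
  · -- monotone
    rw [← hρ.le_iff_le hMa, hρt, hρt]
    exact max_le_max (hlt i hi).le le_rfl
  · -- monotonicity of `φ` on the piece: the `ρ`-image lies in `[tr i, tr (i+1)]` or the piece is a point
    by_cases hdeg : tr (i + 1) ≤ ρ xa
    · -- degenerate piece `t i = t (i+1)` (both clip to `ρ xa`)
      have e1 : t i = t (i + 1) := by
        apply hρ.injective hMa
        rw [hρt, hρt, max_eq_right hdeg, max_eq_right ((htr_mono i (i+1) (Nat.le_succ i) hi).trans hdeg)]
      left
      intro x hx y hy _
      rw [e1, Icc_self] at hx hy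
      rw [mem_singleton_iff.1 hx, mem_singleton_iff.1 hy]
    · push Not at hdeg
      -- image of the piece under `ρ` is inside `[tr i, tr (i+1)]`
      have himg : ∀ x ∈ Icc (t i) (t (i + 1)), ρ x ∈ Icc (tr i) (tr (i + 1)) := by
        intro x hx
        have h1 : ρ (t i) ≤ ρ x := (hρ.strictMono hMa).monotone hx.1
        have h2 : ρ x ≤ ρ (t (i + 1)) := (hρ.strictMono hMa).monotone hx.2
        rw [hρt] at h1 h2
        refine ⟨(le_max_left _ _).trans h1, h2.trans ?_⟩
        exact max_le le_rfl hdeg.le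
      rcases hmono i hi with hV | hV
      · -- `V` increasing ⇒ `φ` antitone
        right
        intro x hx y hy hxy
        have := hV.monotoneOn (himg x hx) (himg y hy) ((hρ.strictMono hMa).monotone hxy)
        simp only; linarith
      · left
        intro x hx y hy hxy
        have := hV.antitoneOn (himg x hx) (himg y hy) ((hρ.strictMono hMa).monotone hxy)
        simp only; linarith

end IsTortoiseRadius

end Kerr

end Literature.Geometry.Lorentzian

end
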